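import Mathlib
import HarnessLib
import Summits.HubbardSuperconductivity.HubbardSuperconductivity.Theorems.KLProgrammeKLRegimeEngineTowerLevLawOfInputsUVDisc
import Summits.HubbardSuperconductivity.HubbardSuperconductivity.Theorems.KLProgrammeKLRegimeEngineTowerLevLawOfRows
import Summits.HubbardSuperconductivity.HubbardSuperconductivity.Theorems.KLProgrammeKLRegimeEngineTowerLevNumericsUV0

/-!
# Route `KLProgramme` — crux K3 ENGINE (stmt-HubbardSuperconductivity-20437 `KLRegimeEngineV17F2`), stub (b) v2, THE LEVELS PACKAGE (ℓ):
# THE LEVELLED TOWER LAW (p4's `_uv` ASSEMBLY) WITH ITS NUMERICS CLOSED AND A FREE B-DISCOUNTED BLOCK-0 PROFILE `(a₀/B², q₀)`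
# (cell gate-hubbard-kl, seat hubbard-kl-k3c3-p2 g14, «(I5)-LEV-UV0»; twin of …TowerLevLawOfRowsUV (= the case `a₀ = q₀ = 0`) on …TowerLevNumericsUV0;
#  E1's (I5)/(I7)-LEV by the substitute precedent)

WHAT.  `klTowerBLev_le_law_of_inputs_uv_disc` with every floor and every kit numeric discharged by the (I5)-LEV-UV0 choices (equational binders, `rfl` at the call)

  `ρ = max 4 (2τψ)`, `Q′ = Z·(Qe.CE/ε_x²) + q₀ + 1`, `Q = ρ·Q′`, `ĉ = 1 + (C₁/C₂)·8^{d−1}`, `Y = ι₂/(2Q′) + W·Z³·X/(4Q′²) + ((W·27⁵·ε_x·ĉ + a₀)/B²)·Q′/2`,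
  `A = 2Y(1−(√2^d)⁻¹)/(W·27⁵·ĉ·Q′)`, `A′ = (W·27⁵·ε_x·ĉ + a₀)/B² + 2Y/Q′`, `ι₃ = W·Z³·X + A′Q′³`   (`ε_x = imagTimeWeight β M`),

where the block-`0` array `μ0` is asked only for a B-DISCOUNTED profile IN ITS OWN CONSTANTS, `μ0 m ≤ (a₀/B²)·λ^{m−1}·q₀^m` (`3 ≤ m ≤ D`, `a₀, q₀ ≥ 0` free of `B` —
the shape k3c2-p3 g13's «(ℓ)-BLOCK0-UV» delivers from p3 g8's weighted grid step once `|U|^{m−1} ≤ B^{−2}λ^{m−1}Klam^{1−m}` is used), the `hstep` binder is k3c2-p3's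
`levLaw_hstep_of_blockBounds` (…TowerLevStepLinkUniform, p666413) by `rfl`, and what remains is: imports `ι₁ ι₂` (I4), the cell `X` («(I2)-F1-HMU»), the BLOCKING row
`max 1 Z · C₂² · max 4 (2τψ) ≤ 2^{d−1}` (`towerLevNumerics_exists_blocking`), the AMPLITUDE rows `8·Φ·τ·Y ≤ 1`, `128·e·ψ³·τ⁴·Φ·(W·27⁵·ĉ)·Y ≤ (1−(√2^d)⁻¹)·ρ³`
(`towerLevNumerics₀_amp_of_le_B`: `B ≥ B₀`), and the coupling smallness — `λ ≤ λ₀` (`klTowerBLev_le_law_uv0_of_rows`) or the two doors at `λ := B·epsCoupling P U j`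
(`klTowerBLev_le_law_uv0_of_doors`).
⊢ `∀ k ≤ K_b, ∀ t, ∀ 3 ≤ p ≤ D, klTowerBLev … d t k p ≤ A·λ^{p−1}·Q^p`.
Composition of landed theorems; nothing about the model is asserted beyond them and the named inputs; nothing asserts (ℓ), any stub, K3 or superconductivity.
References: BGM 2006 §2.8 (2.83), (2.93)–(2.98) [cite: BenfattoGiulianiMastropietro2006].
-/

noncomputable section

namespace Summit.HubbardSuperconductivity.HubbardSuperconductivity.Theorems.EngineV8

set_option linter.dupNamespace false -- summit = problem name (single-conjunct summit), D-0017

open Classical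
open Real Finset Literature.MathematicalPhysics.QuantumLattice Literature.Probability.LatticeModels GrassmannAlgebra
open Literature.MathematicalPhysics.QuantumLattice.FermiRG
open Summit.HubbardSuperconductivity.HubbardSuperconductivity.Theorems.KLProgrammeLegKernels
open Summit.HubbardSuperconductivity.HubbardSuperconductivity.Theorems.KLRegimeSplit
open Summit.HubbardSuperconductivity.HubbardSuperconductivity.Theorems.KLRegimeWick
open Summit.HubbardSuperconductivity.HubbardSuperconductivity.Theorems.TorusFourierL2
open Summit.HubbardSuperconductivity.HubbardSuperconductivity.Theorems.DispersionFlow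

/-- **THE LEVELLED TOWER LAW (`_uv` assembly), NUMERICS CLOSED, FREE BLOCK-0 PROFILE, `λ ≤ λ₀` FORM** (see the module docstring; the equational binders are the explicit (I5)-LEV choices, `rfl` at the call).
[cite: BenfattoGiulianiMastropietro2006, §2.8 (2.83), (2.93)-(2.98)] -/
theorem klTowerBLev_le_law_uv0_of_rows :
    ∃ C₁ C₂ : ℝ, 0 < C₁ ∧ 0 < C₂ ∧ ∀ R : RenConsts, R.WF2 → ∃ c₃' : ℝ, 0 < c₃' ∧ ∃ U₀' : ℝ, 0 < U₀' ∧
      ∀ (P : SplitConsts) (c : ℝ), P.WF → 0 < c → c ≤ klEngC₃6 P R → c ≤ c₃' →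
      ∀ μ ∈ klWindowC, ∀ U : ℝ, 0 < U → U ≤ klEngU₀9 P R c → U ≤ U₀' → ∀ β : ℝ, klBetaMin ≤ β → β ≤ Real.exp (c / U ^ 2) →
      ∀ K : TrigPolyC4v, FrameOK R U (nScales β) μ K → ∀ (L M : ℕ) [NeZero L] [NeZero M],
      klEngL₃ β U ≤ L → klEngM₃ β U L ≤ M → ∀ d Kb D : ℕ, 2 ≤ d → d * Kb - 1 ≤ nScales β + 1 → 3 ≤ D →
      ∀ (Qe : EngConsts), 0 ≤ Qe.CE → KernelNormsLevels L M P Qe β U μ K 0 →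
      ∀ (lam B W Z σ Φ ψ τ ι₁ ι₂ X a₀ q₀ : ℝ), 1 ≤ B → B * epsCoupling P U 0 ≤ lam → 0 < W → 0 < Z →
        0 ≤ σ → 0 ≤ Φ → 0 ≤ ψ → 0 < τ → 0 ≤ ι₁ → 0 ≤ ι₂ → 0 ≤ X → 0 ≤ a₀ → 0 ≤ q₀ →
      -- the explicit (I5)-LEV choices (equational binders)
      ∀ (ρ Q' Q ĉ Y A A' ι₃ : ℝ), ρ = max 4 (2 * τ * ψ) → Q' = Z * (Qe.CE / imagTimeWeight β M ^ 2) + q₀ + 1 → Q = ρ * Q' →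
        ĉ = 1 + C₁ / C₂ * (8 : ℝ) ^ (d - 1) →
        Y = ι₂ / (2 * Q') + W * Z ^ 3 * X / (4 * Q' ^ 2) + (W * (27 : ℝ) ^ 5 * imagTimeWeight β M * ĉ + a₀) / B ^ 2 * Q' / 2 →
        A = 2 * Y * (1 - (Real.sqrt 2 ^ d)⁻¹) / (W * (27 : ℝ) ^ 5 * ĉ * Q') →
        A' = (W * (27 : ℝ) ^ 5 * imagTimeWeight β M * ĉ + a₀) / B ^ 2 + 2 * Y / Q' → ι₃ = W * Z ^ 3 * X + A' * Q' ^ 3 →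
      -- the BLOCKING row and the two AMPLITUDE rows
      max 1 Z * C₂ ^ 2 * max 4 (2 * τ * ψ) ≤ (2 : ℝ) ^ (d - 1) → 8 * Φ * τ * Y ≤ 1 →
        128 * exp 1 * ψ ^ 3 * τ ^ 4 * Φ * (W * (27 : ℝ) ^ 5 * ĉ) * Y ≤ (1 - (Real.sqrt 2 ^ d)⁻¹) * ρ ^ 3 →
      -- the UV array of block 0 (trivial family) and its B-DISCOUNTED profile in its own constants (E1 (I3))
      ∀ μ0 : ℕ → ℝ, (∀ m, 0 ≤ μ0 m) → (∀ m, 3 ≤ m → m ≤ D → μ0 m ≤ a₀ / B ^ 2 * lam ^ (m - 1) * q₀ ^ m) →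
      -- the imports (E1 (I4))
      (∀ k < Kb, (if k = 0 then μ0 1 else W * Z ^ 1 * klTowerMuLev L M β U μ K d k 1) ≤ ι₁ * lam) →
      (∀ k < Kb, (if k = 0 then μ0 2 else W * Z ^ 2 * klTowerMuLev L M β U μ K d k 2) ≤ ι₂ * lam) →
      -- the located six-leg cell «(I2)-F1-HMU»
      (∀ k, 1 ≤ k → k < Kb → klTowerMuLevAt L M β U μ K d 0 k 3 ≤ X * lam ^ 2) →
      -- the step (block 0: `klTowerBLev_one_le_kitStep` at `μ0`; blocks k ≥ 1: `klTowerBLev_succ_le_kitStep`; E1 (I1)/(I5))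
      (∀ t : Fin 5, ∀ k < Kb, ∀ N : ℕ, 2 ≤ N → ∀ p, 3 ≤ p → p ≤ D →
        Φ * towerV D τ (fun m => if k = 0 then μ0 m else W * Z ^ m * klTowerMuLev L M β U μ K d k m) < 1 →
        klTowerBLev L M β U μ K d t (k + 1) p ≤
          towerFO D σ (fun m => if k = 0 then μ0 m else W * Z ^ m * klTowerMuLev L M β U μ K d k m) p +
            ∑ n ∈ Icc 2 N, exp 1 * Φ ^ (n - 1) * ψ ^ p *
              towerS D τ (fun m => if k = 0 then μ0 m else W * Z ^ m * klTowerMuLev L M β U μ K d k m) n p +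
            ψ ^ p * exp 1 * towerV D τ (fun m => if k = 0 then μ0 m else W * Z ^ m * klTowerMuLev L M β U μ K d k m) *
              (Φ * towerV D τ (fun m => if k = 0 then μ0 m else W * Z ^ m * klTowerMuLev L M β U μ K d k m)) ^ N /
              (1 - Φ * towerV D τ (fun m => if k = 0 then μ0 m else W * Z ^ m * klTowerMuLev L M β U μ K d k m))) →
      -- the coupling smallness `λ ≤ λ₀`
      lam ≤ min 1 (min (1 / (8 * σ * Q' + 1)) (min (1 / (2 * exp 1 * τ * Q' + 1)) (min (1 / (4 * Φ * τ * ι₁ + 1))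
        (min (1 / (2 * (Φ * (exp 1 * τ * ι₁ + (exp 1 * τ) ^ 2 * ι₂ + (exp 1 * τ) ^ 3 * ι₃ + A' * (exp 1 * τ * Q') ^ 2 / 2)) + 1))
          (min (A * Q ^ 3 / (16 * σ * Q' * A' * (4 * Q') ^ 3 + A * Q ^ 3))
            (A * Q ^ 3 / (16 * exp 1 * ψ * (2 * τ * ψ * Q') ^ 2 * Φ * τ ^ 2 * ι₁ ^ 2 + A * Q ^ 3))))))) →
      ∀ k ≤ Kb, ∀ (t : Fin 5) (p : ℕ), 3 ≤ p → p ≤ D → klTowerBLev L M β U μ K d t k p ≤ A * lam ^ (p - 1) * Q ^ p := by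
  obtain ⟨C₁, C₂, hC₁, hC₂, h⟩ := klTowerBLev_le_law_of_inputs_uv_disc
  refine ⟨C₁, C₂, hC₁, hC₂, fun R hR2 => ?_⟩
  obtain ⟨c₃, hc₃, U₀, hU₀, h'⟩ := h R hR2
  refine ⟨c₃, hc₃, U₀, hU₀, ?_⟩
  intro P c hP hc hc6 hc₃' μ hμ U hU hU9 hU₀' β hβmin hβc K hK L M _ _ hL3 hM3 d Kb D hd hKbN hD Qe hCE h0 lam B W Z σ Φ ψ τ ι₁ ι₂ X a₀ q₀ hB hεl hW hZ
    hσ hΦ hψ hτ hι₁ hι₂ hX ha₀ hq₀ ρ Q' Q ĉ Y A A' ι₃ hρ hQ' hQ hĉ hY hA hA' hι₃ hblock amp1 amp2 μ0 hμ0 hμ0prof himp₁ himp₂ hcell hstep hle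
  have hx : 0 < imagTimeWeight β M := by
    unfold imagTimeWeight
    have hβ : 0 < β := KLRegimeSplit.pos_of_klBetaMin_le hβmin
    have : (0 : ℝ) < M := Nat.cast_pos.2 (Nat.pos_of_ne_zero (NeZero.ne M))
    positivity
  have hK0 : 0 ≤ P.Klam := le_trans zero_le_one hP.1
  have hε0 : 0 ≤ epsCoupling P U 0 := by unfold epsCoupling; positivity
  have hlam : 0 ≤ lam := le_trans (by positivity) hεl
  obtain ⟨⟨hQ'0, hQ0, hA0, hA'0, _, _⟩, ⟨hF1, hF2, hF3, hF4, hF6, hF7⟩, ⟨hF8, hF9⟩, ⟨hu₁, hu₂⟩, _, _⟩ :=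
    towerLevNumerics₀_rows hW hZ hC₁ hC₂ hd hx hCE hB hι₂ hX ha₀ hq₀ hρ hQ' hQ hĉ hY hA hA' hι₃ hblock amp1 amp2
  obtain ⟨hx₁, hx₂, hx₃, hy, hθ, hclose⟩ :=
    towerLevNumerics₀_side_of_lam_le hσ hΦ hψ hτ hW hZ hC₁ hC₂ hd hx hCE hB hι₁ hι₂ hX ha₀ hq₀ hρ hQ' hQ hĉ hY hA hA' hι₃ hblock amp1 amp2 hlam hle
  have hB0' : 0 < B := lt_of_lt_of_le one_pos hB
  have hμ0prof' : ∀ m, 3 ≤ m → m ≤ D → μ0 m ≤ A' * lam ^ (m - 1) * Q' ^ m := fun m hm hmD =>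
    (hμ0prof m hm hmD).trans (mul_le_mul (mul_le_mul_of_nonneg_right hF8 (pow_nonneg hlam _)) (pow_le_pow_left₀ hq₀ hF9 m)
      (pow_nonneg hq₀ _) (by positivity))
  have hμ03 : μ0 3 ≤ ι₃ * lam ^ 2 :=
    calc μ0 3 ≤ A' * lam ^ (3 - 1) * Q' ^ 3 := hμ0prof' 3 le_rfl hD
      _ = A' * Q' ^ 3 * lam ^ 2 := by ring
      _ ≤ ι₃ * lam ^ 2 := mul_le_mul_of_nonneg_right hF7 (sq_nonneg _)
  exact h' P c hP hc hc6 hc₃' μ hμ U hU hU9 hU₀' β hβmin hβc K hK L M hL3 hM3 d Kb D hd hKbN hD Qe hCE h0 A lam Q B hA0.le hQ0 hB hεl W Z A' Q'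
    hW hZ hF1 hF2 hF3 hF4 hQ'0 σ Φ ψ τ ι₁ ι₂ ι₃ X hσ hΦ hψ hτ hF6 hF7 μ0 hμ0 hμ0prof' hμ03 himp₁ himp₂ hcell hstep hx₁ hx₂ hx₃ hy hθ hu₁ hu₂ hclose

/-- **THE LEVELLED TOWER LAW (`_uv` assembly), NUMERICS CLOSED, FREE BLOCK-0 PROFILE, DOORS FORM** (KL regime): at `λ := B·epsCoupling P U j` (`j ≤ n`, `IsKLRegime U cc (−n)`), the coupling smallness is the
U-door `U ≤ λ₀/(2·B·Klam + 1)` and the c-door `cc ≤ λ₀·log 4/(2·B·Klam + 1)`; everything else as in `klTowerBLev_le_law_uv0_of_rows`.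
[cite: BenfattoGiulianiMastropietro2006, §2.8 (2.83), (2.93)-(2.98)] -/
theorem klTowerBLev_le_law_uv0_of_doors :
    ∃ C₁ C₂ : ℝ, 0 < C₁ ∧ 0 < C₂ ∧ ∀ R : RenConsts, R.WF2 → ∃ c₃' : ℝ, 0 < c₃' ∧ ∃ U₀' : ℝ, 0 < U₀' ∧
      ∀ (P : SplitConsts) (c : ℝ), P.WF → 0 < c → c ≤ klEngC₃6 P R → c ≤ c₃' →
      ∀ μ ∈ klWindowC, ∀ U : ℝ, 0 < U → U ≤ klEngU₀9 P R c → U ≤ U₀' → ∀ β : ℝ, klBetaMin ≤ β → β ≤ Real.exp (c / U ^ 2) →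
      ∀ K : TrigPolyC4v, FrameOK R U (nScales β) μ K → ∀ (L M : ℕ) [NeZero L] [NeZero M],
      klEngL₃ β U ≤ L → klEngM₃ β U L ≤ M → ∀ d Kb D : ℕ, 2 ≤ d → d * Kb - 1 ≤ nScales β + 1 → 3 ≤ D →
      ∀ (Qe : EngConsts), 0 ≤ Qe.CE → KernelNormsLevels L M P Qe β U μ K 0 →
      ∀ (cc : ℝ) (n j : ℕ), IsKLRegime U cc (-(n : ℤ)) → j ≤ n →
      ∀ (B W Z σ Φ ψ τ ι₁ ι₂ X a₀ q₀ : ℝ), 1 ≤ B → 0 < W → 0 < Z →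
        0 ≤ σ → 0 ≤ Φ → 0 ≤ ψ → 0 < τ → 0 ≤ ι₁ → 0 ≤ ι₂ → 0 ≤ X → 0 ≤ a₀ → 0 ≤ q₀ →
      -- the explicit (I5)-LEV choices (equational binders)
      ∀ (ρ Q' Q ĉ Y A A' ι₃ : ℝ), ρ = max 4 (2 * τ * ψ) → Q' = Z * (Qe.CE / imagTimeWeight β M ^ 2) + q₀ + 1 → Q = ρ * Q' →
        ĉ = 1 + C₁ / C₂ * (8 : ℝ) ^ (d - 1) →
        Y = ι₂ / (2 * Q') + W * Z ^ 3 * X / (4 * Q' ^ 2) + (W * (27 : ℝ) ^ 5 * imagTimeWeight β M * ĉ + a₀) / B ^ 2 * Q' / 2 →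
        A = 2 * Y * (1 - (Real.sqrt 2 ^ d)⁻¹) / (W * (27 : ℝ) ^ 5 * ĉ * Q') →
        A' = (W * (27 : ℝ) ^ 5 * imagTimeWeight β M * ĉ + a₀) / B ^ 2 + 2 * Y / Q' → ι₃ = W * Z ^ 3 * X + A' * Q' ^ 3 →
      -- the BLOCKING row and the two AMPLITUDE rows
      max 1 Z * C₂ ^ 2 * max 4 (2 * τ * ψ) ≤ (2 : ℝ) ^ (d - 1) → 8 * Φ * τ * Y ≤ 1 →
        128 * exp 1 * ψ ^ 3 * τ ^ 4 * Φ * (W * (27 : ℝ) ^ 5 * ĉ) * Y ≤ (1 - (Real.sqrt 2 ^ d)⁻¹) * ρ ^ 3 →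
      -- the UV array of block 0 (trivial family) and its B-DISCOUNTED profile in its own constants, `λ = B·ε_j` (E1 (I3))
      ∀ μ0 : ℕ → ℝ, (∀ m, 0 ≤ μ0 m) → (∀ m, 3 ≤ m → m ≤ D → μ0 m ≤ a₀ / B ^ 2 * (B * epsCoupling P U j) ^ (m - 1) * q₀ ^ m) →
      -- the imports (E1 (I4)) at `λ = B·ε_j`
      (∀ k < Kb, (if k = 0 then μ0 1 else W * Z ^ 1 * klTowerMuLev L M β U μ K d k 1) ≤ ι₁ * (B * epsCoupling P U j)) →
      (∀ k < Kb, (if k = 0 then μ0 2 else W * Z ^ 2 * klTowerMuLev L M β U μ K d k 2) ≤ ι₂ * (B * epsCoupling P U j)) →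
      -- the located six-leg cell «(I2)-F1-HMU»
      (∀ k, 1 ≤ k → k < Kb → klTowerMuLevAt L M β U μ K d 0 k 3 ≤ X * (B * epsCoupling P U j) ^ 2) →
      -- the step (block 0 at `μ0`, blocks k ≥ 1 at `W·Z^m·klTowerMuLev`; E1 (I1)/(I5))
      (∀ t : Fin 5, ∀ k < Kb, ∀ N : ℕ, 2 ≤ N → ∀ p, 3 ≤ p → p ≤ D →
        Φ * towerV D τ (fun m => if k = 0 then μ0 m else W * Z ^ m * klTowerMuLev L M β U μ K d k m) < 1 →
        klTowerBLev L M β U μ K d t (k + 1) p ≤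
          towerFO D σ (fun m => if k = 0 then μ0 m else W * Z ^ m * klTowerMuLev L M β U μ K d k m) p +
            ∑ n ∈ Icc 2 N, exp 1 * Φ ^ (n - 1) * ψ ^ p *
              towerS D τ (fun m => if k = 0 then μ0 m else W * Z ^ m * klTowerMuLev L M β U μ K d k m) n p +
            ψ ^ p * exp 1 * towerV D τ (fun m => if k = 0 then μ0 m else W * Z ^ m * klTowerMuLev L M β U μ K d k m) *
              (Φ * towerV D τ (fun m => if k = 0 then μ0 m else W * Z ^ m * klTowerMuLev L M β U μ K d k m)) ^ N /
              (1 - Φ * towerV D τ (fun m => if k = 0 then μ0 m else W * Z ^ m * klTowerMuLev L M β U μ K d k m))) →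
      -- the two doors
      U ≤ min 1 (min (1 / (8 * σ * Q' + 1)) (min (1 / (2 * exp 1 * τ * Q' + 1)) (min (1 / (4 * Φ * τ * ι₁ + 1))
        (min (1 / (2 * (Φ * (exp 1 * τ * ι₁ + (exp 1 * τ) ^ 2 * ι₂ + (exp 1 * τ) ^ 3 * ι₃ + A' * (exp 1 * τ * Q') ^ 2 / 2)) + 1))
          (min (A * Q ^ 3 / (16 * σ * Q' * A' * (4 * Q') ^ 3 + A * Q ^ 3))
            (A * Q ^ 3 / (16 * exp 1 * ψ * (2 * τ * ψ * Q') ^ 2 * Φ * τ ^ 2 * ι₁ ^ 2 + A * Q ^ 3))))))) / (2 * B * P.Klam + 1) →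
      cc ≤ min 1 (min (1 / (8 * σ * Q' + 1)) (min (1 / (2 * exp 1 * τ * Q' + 1)) (min (1 / (4 * Φ * τ * ι₁ + 1))
        (min (1 / (2 * (Φ * (exp 1 * τ * ι₁ + (exp 1 * τ) ^ 2 * ι₂ + (exp 1 * τ) ^ 3 * ι₃ + A' * (exp 1 * τ * Q') ^ 2 / 2)) + 1))
          (min (A * Q ^ 3 / (16 * σ * Q' * A' * (4 * Q') ^ 3 + A * Q ^ 3))
            (A * Q ^ 3 / (16 * exp 1 * ψ * (2 * τ * ψ * Q') ^ 2 * Φ * τ ^ 2 * ι₁ ^ 2 + A * Q ^ 3))))))) * Real.log 4 / (2 * B * P.Klam + 1) →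
      ∀ k ≤ Kb, ∀ (t : Fin 5) (p : ℕ), 3 ≤ p → p ≤ D →
        klTowerBLev L M β U μ K d t k p ≤ A * (B * epsCoupling P U j) ^ (p - 1) * Q ^ p := by
  obtain ⟨C₁, C₂, hC₁, hC₂, h⟩ := klTowerBLev_le_law_of_inputs_uv_disc
  refine ⟨C₁, C₂, hC₁, hC₂, fun R hR2 => ?_⟩
  obtain ⟨c₃, hc₃, U₀, hU₀, h'⟩ := h R hR2
  refine ⟨c₃, hc₃, U₀, hU₀, ?_⟩
  intro P c hP hc hc6 hc₃' μ hμ U hU hU9 hU₀' β hβmin hβc K hK L M _ _ hL3 hM3 d Kb D hd hKbN hD Qe hCE h0 cc n j hreg hj B W Z σ Φ ψ τ ι₁ ι₂ X a₀ q₀ hB hW hZ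
    hσ hΦ hψ hτ hι₁ hι₂ hX ha₀ hq₀ ρ Q' Q ĉ Y A A' ι₃ hρ hQ' hQ hĉ hY hA hA' hι₃ hblock amp1 amp2 μ0 hμ0 hμ0prof himp₁ himp₂ hcell hstep hUdoor hcdoor
  have hx : 0 < imagTimeWeight β M := by
    unfold imagTimeWeight
    have hβ : 0 < β := KLRegimeSplit.pos_of_klBetaMin_le hβmin
    have : (0 : ℝ) < M := Nat.cast_pos.2 (Nat.pos_of_ne_zero (NeZero.ne M))
    positivity
  have hK0 : 0 ≤ P.Klam := le_trans zero_le_one hP.1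
  have hB0 : 0 ≤ B := le_trans zero_le_one hB
  have hεl : B * epsCoupling P U 0 ≤ B * epsCoupling P U j := mul_le_mul_of_nonneg_left (epsCoupling_zero_le_epsCoupling hK0 U j) hB0
  obtain ⟨⟨hQ'0, hQ0, hA0, hA'0, _, _⟩, ⟨hF1, hF2, hF3, hF4, hF6, hF7⟩, ⟨hF8, hF9⟩, ⟨hu₁, hu₂⟩, _, _⟩ :=
    towerLevNumerics₀_rows hW hZ hC₁ hC₂ hd hx hCE hB hι₂ hX ha₀ hq₀ hρ hQ' hQ hĉ hY hA hA' hι₃ hblock amp1 amp2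
  obtain ⟨hx₁, hx₂, hx₃, hy, hθ, hclose⟩ :=
    towerLevNumerics₀_side_of_doors hK0 hσ hΦ hψ hτ hW hZ hC₁ hC₂ hd hx hCE hB hι₁ hι₂ hX ha₀ hq₀ hB0 hU.le hreg hj hρ hQ' hQ hĉ hY hA hA' hι₃ hblock
      amp1 amp2 hUdoor hcdoor
  have hε0 : 0 ≤ epsCoupling P U j := by unfold epsCoupling; positivity
  have hlam : 0 ≤ B * epsCoupling P U j := mul_nonneg hB0 hε0
  have hμ0prof' : ∀ m, 3 ≤ m → m ≤ D → μ0 m ≤ A' * (B * epsCoupling P U j) ^ (m - 1) * Q' ^ m := fun m hm hmD =>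
    (hμ0prof m hm hmD).trans (mul_le_mul (mul_le_mul_of_nonneg_right hF8 (pow_nonneg hlam _)) (pow_le_pow_left₀ hq₀ hF9 m)
      (pow_nonneg hq₀ _) (by positivity))
  have hμ03 : μ0 3 ≤ ι₃ * (B * epsCoupling P U j) ^ 2 :=
    calc μ0 3 ≤ A' * (B * epsCoupling P U j) ^ (3 - 1) * Q' ^ 3 := hμ0prof' 3 le_rfl hD
      _ = A' * Q' ^ 3 * (B * epsCoupling P U j) ^ 2 := by ring
      _ ≤ ι₃ * (B * epsCoupling P U j) ^ 2 := mul_le_mul_of_nonneg_right hF7 (sq_nonneg _)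
  exact h' P c hP hc hc6 hc₃' μ hμ U hU hU9 hU₀' β hβmin hβc K hK L M hL3 hM3 d Kb D hd hKbN hD Qe hCE h0 A (B * epsCoupling P U j) Q B hA0.le hQ0 hB hεl
    W Z A' Q' hW hZ hF1 hF2 hF3 hF4 hQ'0 σ Φ ψ τ ι₁ ι₂ ι₃ X hσ hΦ hψ hτ hF6 hF7 μ0 hμ0 hμ0prof' hμ03 himp₁ himp₂ hcell hstep hx₁ hx₂ hx₃ hy hθ hu₁ hu₂
    hclose

end Summit.HubbardSuperconductivity.HubbardSuperconductivity.Theorems.EngineV8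

end
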